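import Summits.QuantumFields.YangMills.Theorems.FluctuationComparisonRegPrIntLS2BetaCovWalkSumStokes
import Literature.MathematicalPhysics.QuantumFieldTheory.Balaban1983to89.B12Average05And08
import HarnessLib

/-!
# S2β · (RES-u.5) «THE FEED» — word-oscillation algebra for the rows' datum at the moved Thm-2 representative: SUMS (subadditive), POINTWISE-SMALL corrections (`+2β`), and the
# logarithm of a product `log(W·X) = log W + log X + O((p+q)²)` — so `osc(log(e^{ηA}·E)) ≤ osc(ηA) + 2·‖log E‖ + 2·4(p+q)²` (architect px17 g23 01:09:08Z «(RES-u.5) FEED → px13»)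

Cell `ym3-torus` (YM ladder rung R3 = continuum `SU(2)` Yang–Mills on the three-torus at fixed lattice data — a RUNG: NOT d = 4, NOT infinite volume, NOT a mass gap,
NOT Clay).  Width seat `ym3-torus-px13` (gen 29); crux `stmt-QuantumFields-20520`, LINE g18-1 S2β, node (RES-u) «from Thm 2's `u` to a residual re-gauging» — item (RES-u.5), the
oscillation∕read-cell packaging after (RES-u.4) ✓p839678 `…ResidualCommutatorLetter` (w5 g28: the SIZES of the commutator factor `E`).  `--kind proof --supports stmt-QuantumFields-20520
--as helper`, count-neutral, DEFINITION-FREE (0 `def`, 0 `instance`, 0 `notation`, 0 `sorry`, default heartbeats).  Torus side, level-generic `j`, `SU(N)`, matrix data; the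
word-oscillation shape is FILE A1's `‖↑(holAt U₀ (walk x w))·F⟨walkEnd x w, κ⟩·(…)⋆ − F⟨x, κ⟩‖ ≤ |w|·c` (consumed by ✓-pending FILE B `hOSC_tower`'s `h0` and by ✓p839541 §3 via FILE B §1).

WHAT IS PROVED (sorry-free).
§1 `wordOsc_add` (constants add under `F₁ + F₂`), `wordOsc_smul` (scale by `‖a‖`), `wordOsc_of_pointwise` (`‖F b‖ ≤ β` ⟹ constant `2β`), ★`wordOsc_of_approx` (`‖F b − G b‖ ≤ β` and `G` has constant
   `c` ⟹ `F` has constant `c + 2β`).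
§2 ★★`wordOsc_mlog_mul` — for bond matrices `W, X` with `‖W b − 1‖ ≤ p ≤ 1∕10`, `‖X b − 1‖ ≤ q ≤ 1∕10`: if `mlog ∘ W` has word-oscillation `c` then `b ↦ mlog (W b·X b)` has word-oscillation
   `c + 2·(2q) + 2·(4(p+q)²)` (lit ✓`B12Average05And08.norm_mlog_mul_sub_le` (0.8)∕(26)–(27) + ✓`MatrixLog.norm_mlog_le_two_mul`) — the rows' level-0 datum `log(e^{ηA}·E)` at the
   moved representative: `osc ≤ osc(ηA)` [(R-3) ✓p839541] `+ 2‖log E‖` [(RES-u.4): `‖E − 1‖ ≤ 2στ + τ′`] `+` the quadratic junk (class (c) once multiplied by `M` in the source).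

HONEST.  Triangle inequalities over landed letters; `p, q, c` HYPOTHESES; nothing of Bałaban's analysis is proved ([Balaban1985Averaging] (26)–(27) p.22 is the printed second-order
logarithm); the identification of the rows' `X 0` with `mlog(e^{ηA}·E)` is the (RES-u.0)–(RES-u.3) doors' (px16), NOT here; (RES-u), (REG-UP)'s `ε`, GAP♯∘ (registry 3732b7df UNTOUCHED,
0∕5), S2β, crux 20520, 19936, 19200, `YM3TorusSU2` — NOT proved; rung R3 — NOT d = 4, NOT infinite volume, NOT a mass gap, NOT Clay; the Yang–Mills mass gap is NOT proved.
-/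

set_option autoImplicit false

noncomputable section

open scoped Matrix.Norms.L2Operator

namespace Summit.QuantumFields.YangMills.Theorems.FluctuationComparisonRegPrIntLS2BetaCovariantOscillationFeed

open Literature.MathematicalPhysics.QuantumFieldTheory.Balaban1983to89
open T4Continuum (walk walkEnd holAt Letter)
open MatrixLog (mlog norm_mlog_le_two_mul)
open B12Average05And08 (norm_mlog_mul_sub_le)
open Summit.QuantumFields.YangMills.Theorems.FluctuationComparisonRegPrIntLS2BetaCovWalkSumStokes (norm_coe_conj_le)

variable {P : Params} {j N : ℕ} [NeZero N] (U₀ : GaugeField P j (Matrix.specialUnitaryGroup (Fin N) ℂ))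

/-! ## §1 Word-oscillation algebra -/

section Algebra

/-- **SUMS**: word-oscillation constants add. [folklore] -/
theorem wordOsc_add (F₁ F₂ : PBond P j → Matrix (Fin N) (Fin N) ℂ) {c₁ c₂ : ℝ}
    (h₁ : ∀ (x : Site P j) (w : List (Letter P.d)) (κ : Fin P.d),
      ‖((holAt U₀ (walk x w) : Matrix.specialUnitaryGroup (Fin N) ℂ) : Matrix (Fin N) (Fin N) ℂ) * F₁ ⟨walkEnd x w, κ⟩ *
          star ((holAt U₀ (walk x w) : Matrix.specialUnitaryGroup (Fin N) ℂ) : Matrix (Fin N) (Fin N) ℂ) - F₁ ⟨x, κ⟩‖ ≤ (w.length : ℝ) * c₁)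
    (h₂ : ∀ (x : Site P j) (w : List (Letter P.d)) (κ : Fin P.d),
      ‖((holAt U₀ (walk x w) : Matrix.specialUnitaryGroup (Fin N) ℂ) : Matrix (Fin N) (Fin N) ℂ) * F₂ ⟨walkEnd x w, κ⟩ *
          star ((holAt U₀ (walk x w) : Matrix.specialUnitaryGroup (Fin N) ℂ) : Matrix (Fin N) (Fin N) ℂ) - F₂ ⟨x, κ⟩‖ ≤ (w.length : ℝ) * c₂)
    (x : Site P j) (w : List (Letter P.d)) (κ : Fin P.d) :
    ‖((holAt U₀ (walk x w) : Matrix.specialUnitaryGroup (Fin N) ℂ) : Matrix (Fin N) (Fin N) ℂ) * (F₁ ⟨walkEnd x w, κ⟩ + F₂ ⟨walkEnd x w, κ⟩) *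
        star ((holAt U₀ (walk x w) : Matrix.specialUnitaryGroup (Fin N) ℂ) : Matrix (Fin N) (Fin N) ℂ) - (F₁ ⟨x, κ⟩ + F₂ ⟨x, κ⟩)‖ ≤ (w.length : ℝ) * (c₁ + c₂) := by
  have e : ((holAt U₀ (walk x w) : Matrix.specialUnitaryGroup (Fin N) ℂ) : Matrix (Fin N) (Fin N) ℂ) * (F₁ ⟨walkEnd x w, κ⟩ + F₂ ⟨walkEnd x w, κ⟩) *
        star ((holAt U₀ (walk x w) : Matrix.specialUnitaryGroup (Fin N) ℂ) : Matrix (Fin N) (Fin N) ℂ) - (F₁ ⟨x, κ⟩ + F₂ ⟨x, κ⟩) =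
      (((holAt U₀ (walk x w) : Matrix.specialUnitaryGroup (Fin N) ℂ) : Matrix (Fin N) (Fin N) ℂ) * F₁ ⟨walkEnd x w, κ⟩ *
          star ((holAt U₀ (walk x w) : Matrix.specialUnitaryGroup (Fin N) ℂ) : Matrix (Fin N) (Fin N) ℂ) - F₁ ⟨x, κ⟩) +
      (((holAt U₀ (walk x w) : Matrix.specialUnitaryGroup (Fin N) ℂ) : Matrix (Fin N) (Fin N) ℂ) * F₂ ⟨walkEnd x w, κ⟩ *
          star ((holAt U₀ (walk x w) : Matrix.specialUnitaryGroup (Fin N) ℂ) : Matrix (Fin N) (Fin N) ℂ) - F₂ ⟨x, κ⟩) := by noncomm_ring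
  rw [e, mul_add]
  exact (norm_add_le _ _).trans (add_le_add (h₁ x w κ) (h₂ x w κ))

/-- **POINTWISE SMALL ⟹ SMALL OSCILLATION**: `‖F b‖ ≤ β` everywhere ⟹ constant `2β` (for the empty word both sides vanish). [folklore] -/
theorem wordOsc_of_pointwise (F : PBond P j → Matrix (Fin N) (Fin N) ℂ) {β : ℝ} (hβ : ∀ b, ‖F b‖ ≤ β)
    (x : Site P j) (w : List (Letter P.d)) (κ : Fin P.d) :
    ‖((holAt U₀ (walk x w) : Matrix.specialUnitaryGroup (Fin N) ℂ) : Matrix (Fin N) (Fin N) ℂ) * F ⟨walkEnd x w, κ⟩ *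
        star ((holAt U₀ (walk x w) : Matrix.specialUnitaryGroup (Fin N) ℂ) : Matrix (Fin N) (Fin N) ℂ) - F ⟨x, κ⟩‖ ≤ (w.length : ℝ) * (2 * β) := by
  have hβ0 : 0 ≤ β := (norm_nonneg _).trans (hβ ⟨x, κ⟩)
  cases w with
  | nil => simp [walk, walkEnd, T4Continuum.holAt_nil]
  | cons l w =>
    have hlen : (1 : ℝ) ≤ ((l :: w).length : ℝ) := by simp
    calc _ ≤ ‖((holAt U₀ (walk x (l :: w)) : Matrix.specialUnitaryGroup (Fin N) ℂ) : Matrix (Fin N) (Fin N) ℂ) * F ⟨walkEnd x (l :: w), κ⟩ *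
            star ((holAt U₀ (walk x (l :: w)) : Matrix.specialUnitaryGroup (Fin N) ℂ) : Matrix (Fin N) (Fin N) ℂ)‖ + ‖F ⟨x, κ⟩‖ := norm_sub_le _ _
      _ ≤ β + β := add_le_add ((norm_coe_conj_le _ _).trans (hβ _)) (hβ _)
      _ = 1 * (2 * β) := by ring
      _ ≤ ((l :: w).length : ℝ) * (2 * β) := mul_le_mul_of_nonneg_right hlen (by linarith)

/-- ★ **APPROXIMATION**: if `G` has word-oscillation `c` and `‖F b − G b‖ ≤ β` everywhere, then `F` has word-oscillation `c + 2β`. [folklore] -/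
theorem wordOsc_of_approx (F G : PBond P j → Matrix (Fin N) (Fin N) ℂ) {c β : ℝ}
    (hG : ∀ (x : Site P j) (w : List (Letter P.d)) (κ : Fin P.d),
      ‖((holAt U₀ (walk x w) : Matrix.specialUnitaryGroup (Fin N) ℂ) : Matrix (Fin N) (Fin N) ℂ) * G ⟨walkEnd x w, κ⟩ *
          star ((holAt U₀ (walk x w) : Matrix.specialUnitaryGroup (Fin N) ℂ) : Matrix (Fin N) (Fin N) ℂ) - G ⟨x, κ⟩‖ ≤ (w.length : ℝ) * c)
    (hβ : ∀ b, ‖F b - G b‖ ≤ β) (x : Site P j) (w : List (Letter P.d)) (κ : Fin P.d) :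
    ‖((holAt U₀ (walk x w) : Matrix.specialUnitaryGroup (Fin N) ℂ) : Matrix (Fin N) (Fin N) ℂ) * F ⟨walkEnd x w, κ⟩ *
        star ((holAt U₀ (walk x w) : Matrix.specialUnitaryGroup (Fin N) ℂ) : Matrix (Fin N) (Fin N) ℂ) - F ⟨x, κ⟩‖ ≤ (w.length : ℝ) * (c + 2 * β) := by
  have hsplit : F = fun b => G b + (F b - G b) := by funext b; abel
  have h := wordOsc_add U₀ G (fun b => F b - G b) hG (wordOsc_of_pointwise U₀ (fun b => F b - G b) hβ) x w κ
  rw [hsplit]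
  exact h

end Algebra

/-! ## §2 ★★ The logarithm of a product -/

section LogProduct

/-- ★★ **THE FEED FOR THE MOVED REPRESENTATIVE'S DATUM `log(W·X)`**: bond matrices `W, X` with `‖W b − 1‖ ≤ p ≤ 1∕10`, `‖X b − 1‖ ≤ q ≤ 1∕10`; if `b ↦ mlog (W b)` has word-oscillation `c`
(in `U₀`'s transport) then `b ↦ mlog (W b·X b)` has word-oscillation `c + 2·(2q) + 2·(4·(p+q)²)`: the second factor enters through its SIZE only (`‖mlog X‖ ≤ 2q`), the product through the
second-order logarithm `‖mlog(WX) − mlog W − mlog X‖ ≤ 4(p+q)²` ([Balaban1985Averaging] (26)–(27), lit ✓`norm_mlog_mul_sub_le`).  At the moved Thm-2 representative: `W = e^{ηA}` ((R-3)),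
`X = E` ((RES-u.4): `q = 2στ + τ′`). [cite: Balaban1985Averaging, (26)-(27) p.22; Balaban1985RegularSpaces, Thm 2 p.83, (1.36) p.82] -/
theorem wordOsc_mlog_mul (W X : PBond P j → Matrix (Fin N) (Fin N) ℂ) {p q c : ℝ}
    (hW : ∀ b, ‖W b - 1‖ ≤ p) (hX : ∀ b, ‖X b - 1‖ ≤ q) (hp : p ≤ 1 / 10) (hq : q ≤ 1 / 10)
    (hc : ∀ (x : Site P j) (w : List (Letter P.d)) (κ : Fin P.d),
      ‖((holAt U₀ (walk x w) : Matrix.specialUnitaryGroup (Fin N) ℂ) : Matrix (Fin N) (Fin N) ℂ) * mlog (W ⟨walkEnd x w, κ⟩) *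
          star ((holAt U₀ (walk x w) : Matrix.specialUnitaryGroup (Fin N) ℂ) : Matrix (Fin N) (Fin N) ℂ) - mlog (W ⟨x, κ⟩)‖ ≤ (w.length : ℝ) * c)
    (x : Site P j) (w : List (Letter P.d)) (κ : Fin P.d) :
    ‖((holAt U₀ (walk x w) : Matrix.specialUnitaryGroup (Fin N) ℂ) : Matrix (Fin N) (Fin N) ℂ) * mlog (W ⟨walkEnd x w, κ⟩ * X ⟨walkEnd x w, κ⟩) *
        star ((holAt U₀ (walk x w) : Matrix.specialUnitaryGroup (Fin N) ℂ) : Matrix (Fin N) (Fin N) ℂ) - mlog (W ⟨x, κ⟩ * X ⟨x, κ⟩)‖ ≤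
      (w.length : ℝ) * ((c + 2 * (2 * q)) + 2 * (4 * (p + q) ^ 2)) := by
  -- `G := mlog W + mlog X` has constant `c + 2·(2q)`; `F := mlog (W·X)` is within `4(p+q)²` of `G`
  have hXlog : ∀ b, ‖mlog (X b)‖ ≤ 2 * q := fun b =>
    (norm_mlog_le_two_mul ((hX b).trans (by linarith))).trans (by linarith [hX b])
  have hG := wordOsc_add U₀ (fun b => mlog (W b)) (fun b => mlog (X b)) hc (wordOsc_of_pointwise U₀ (fun b => mlog (X b)) hXlog)
  have hβ : ∀ b, ‖mlog (W b * X b) - (mlog (W b) + mlog (X b))‖ ≤ 4 * (p + q) ^ 2 := fun b => by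
    rw [show mlog (W b * X b) - (mlog (W b) + mlog (X b)) = mlog (W b * X b) - mlog (W b) - mlog (X b) by abel]
    exact norm_mlog_mul_sub_le (hW b) (hX b) hp hq
  exact wordOsc_of_approx U₀ (fun b => mlog (W b * X b)) (fun b => mlog (W b) + mlog (X b)) hG hβ x w κ

end LogProduct

end Summit.QuantumFields.YangMills.Theorems.FluctuationComparisonRegPrIntLS2BetaCovariantOscillationFeed

end
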